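import Summits.SmoothPoincare4.SmoothPoincare4.Theses.WeakReductionDescent
import Literature.Topology.FourManifolds.SphereTrisectionsSectors
import Literature.Topology.FourManifolds.TrisectionFunctorGKNaturality
import Literature.Topology.FourManifolds.WeaklyReducibleTrisections
import Literature.Topology.FourManifolds.CircleSurgery

/-!
# Crux `WeakReductionReduces` (stmt-SmoothPoincare4-17908), line `loop_dichotomy`, stub D
# (`stub_loopDichotomy`) — auxiliary file 1: rung 3 of D is the route item `GenusThreeBase`

Stub D (`stub_loopDichotomy`, crux-strength; Aranda–Zupan one dimension up, NO minimality): a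
weakly reducible GK-trisection of genus `g ≥ 3` of a smooth homotopy `4`-sphere `M` is reducible,
OR `M` has a GK-trisection of genus `< g`, OR `M` is a surgery on a smoothly embedded loop in a
closed smooth `X` with a GK-trisection of genus `< g`.  This file records, kernel-checked, WHERE
its open content sits:

* `helper_loopDichotomy_genusThree_of_genusThreeBase` — rung `g = 3` of D follows from the route
  item `GenusThreeBase` (⇔ the vendored named fact
  `Literature.Barriers.SmoothPoincare4.az2025_weaklyReducible_genusThree_homotopySphere_gk.{0}`,
  Aranda–Zupan 2025 Thm. 1.3, by `genusThreeBase_iff_az2025` in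
  `Theorems/WeakReductionDescentGenusThreeBase.lean`) through the MIDDLE exit: `M ≅ S⁴` carries
  Gay–Kirby's genus-`0` trisection (`sphere_genusZero_gkTrisection_holds`, transported by
  `IsGKTrisection.image_diffeomorph'`, both PROVED);
* `helper_loopDichotomy_of_fromFour` — hence D ⇐ `GenusThreeBase` ∧ D restricted to `g ≥ 4`:
  the only open content of D is the rungs `g ≥ 4` ("Aranda–Zupan at genus ≥ 4 for homotopy
  spheres"), which is also all the line's composition `weakReductionReduces_of_pieces` consumes
  (it calls D with `4 ≤ g`).

Both are registered helpers of the crux (conditional on the route item, D-0014); nothing is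
restated, no fact is introduced.

## References

* R. Aranda, A. Zupan, arXiv:2503.04607 (2025): Thm. 1.3 (p. 2), §5 (five-chains as loop
  surgeries), §8 Prop. 8.1. [ArandaZupan2025]
* D. Gay, R. Kirby, Geom. Topol. 20 (2016): §2 (genus-0 trisection of `S⁴`). [GayKirby2016]
-/

-- the registered namespace `Summit.SmoothPoincare4.SmoothPoincare4.Theorems…` repeats a component
set_option linter.dupNamespace false

noncomputable section

open scoped Manifold ContDiff Topology ContinuousMap
open Set
open Literature.Topology.FourManifolds
open Summit.SmoothPoincare4.SmoothPoincare4.Theses.WeakReductionDescent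

namespace Summit.SmoothPoincare4.SmoothPoincare4.Theorems.WeakReductionReduces.LoopDichotomy

/-- **Rung `g = 3` of D from the route item `GenusThreeBase`** (registered helper of crux
stmt-SmoothPoincare4-17908).  If every smooth homotopy `4`-sphere with a weakly reducible genus-`3`
GK-trisection is diffeomorphic to `S⁴` (`GenusThreeBase` ⇔ Aranda–Zupan 2025 Thm. 1.3,
homotopy-sphere corollary), then D holds at genus `3` through its middle exit: along
`Φ : M ≅ S⁴` the genus-`0` trisection of the round sphere (Gay–Kirby §2; PROVED,
`sphere_genusZero_gkTrisection_holds`) pulls back to a GK-trisection of `M` of genus `0 < 3`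
(`IsGKTrisection.image_diffeomorph'`, PROVED).  Conditional on the item (D-0014).
[cite: ArandaZupan2025, Thm. 1.3 (p. 2)] [cite: GayKirby2016, §2 (first example)] -/
theorem helper_loopDichotomy_genusThree_of_genusThreeBase :
    Summit.SmoothPoincare4.SmoothPoincare4.Theses.WeakReductionDescent.GenusThreeBase → ∀ (M : Type) [TopologicalSpace M] [T2Space M] [SecondCountableTopology M] [ChartedSpace (EuclideanSpace ℝ (Fin 4)) M] [IsManifold (𝓡 4) ((⊤ : ℕ∞) : WithTop ℕ∞) M], (M ≃ₕ (Metric.sphere (0 : EuclideanSpace ℝ (Fin 5)) 1)) → ∀ (k : Fin 3 → ℕ) (T : Fin 3 → Set M), Literature.Topology.FourManifolds.IsGKTrisection M 3 k T → Literature.Topology.FourManifolds.Trisection.IsWeaklyReducible T → Literature.Topology.FourManifolds.Trisection.IsReducible T ∨ (∃ (g₁ : ℕ) (k₁ : Fin 3 → ℕ) (T₁ : Fin 3 → Set M), g₁ < 3 ∧ Literature.Topology.FourManifolds.IsGKTrisection M g₁ k₁ T₁) ∨ (∃ (X : Type) (_ : TopologicalSpace X) (_ : T2Space X) (_ : SecondCountableTopology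 X) (_ : ChartedSpace (EuclideanSpace ℝ (Fin 4)) X) (_ : IsManifold (𝓡 4) ((⊤ : ℕ∞) : WithTop ℕ∞) X) (g' : ℕ) (k' : Fin 3 → ℕ) (T' : Fin 3 → Set X) (ℓ : (Metric.sphere (0 : EuclideanSpace ℝ (Fin 2)) 1) → X), g' < 3 ∧ Literature.Topology.FourManifolds.IsGKTrisection X g' k' T' ∧ Manifold.IsSmoothEmbedding (𝓡 1) (𝓡 4) ((⊤ : ℕ∞) : WithTop ℕ∞) ℓ ∧ Literature.Topology.FourManifolds.IsCircleSurgery (𝓡 4) (𝓡 4) X M ℓ) := by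
  intro h3 M _ _ _ _ _ e k T hT hwr
  obtain ⟨Φ⟩ := h3 M e k T hT ((Trisection.isWeaklyReducible_iff T).1 hwr)
  obtain ⟨S₀, hS₀⟩ := sphere_genusZero_gkTrisection_holds
  exact Or.inr (Or.inl ⟨0, fun _ => 0, fun i => Φ.symm '' S₀ i, by omega,
    hS₀.isGKTrisection.image_diffeomorph' Φ.symm⟩)

/-- **D from its rungs `g ≥ 4` and `GenusThreeBase`** (registered helper of crux
stmt-SmoothPoincare4-17908): the registered stub `stub_loopDichotomy` (genus `g ≥ 3`, no
minimality) follows from its own restriction to `g ≥ 4` together with the route item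
`GenusThreeBase` (rung `3`, `helper_loopDichotomy_genusThree_of_genusThreeBase`).  So the open
content of D is exactly "Aranda–Zupan at genus `≥ 4` for homotopy spheres"; the line's glue
`weakReductionReduces_of_pieces` only ever calls D with `4 ≤ g`. [cite: ArandaZupan2025, Thm. 1.3 (p. 2) and §8 Prop. 8.1] -/
theorem helper_loopDichotomy_of_fromFour :
    Summit.SmoothPoincare4.SmoothPoincare4.Theses.WeakReductionDescent.GenusThreeBase → (∀ (M : Type) [TopologicalSpace M] [T2Space M] [SecondCountableTopology M] [ChartedSpace (EuclideanSpace ℝ (Fin 4)) M] [IsManifold (𝓡 4) ((⊤ : ℕ∞) : WithTop ℕ∞) M], (M ≃ₕ (Metric.sphere (0 : EuclideanSpace ℝ (Fin 5)) 1)) → ∀ (g : ℕ) (k : Fin 3 → ℕ) (T : Fin 3 → Set M), Literature.Topology.FourManifolds.IsGKTrisection M g k T → 4 ≤ g → Literature.Topology.FourManifolds.Trisection.IsWeaklyReducible T → Literature.Topology.FourManifolds.Trisection.IsReducible T ∨ (∃ (g₁ : ℕ) (k₁ : Fin 3 → ℕ) (T₁ : Fin 3 → Set M), g₁ < g ∧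 Literature.Topology.FourManifolds.IsGKTrisection M g₁ k₁ T₁) ∨ (∃ (X : Type) (_ : TopologicalSpace X) (_ : T2Space X) (_ : SecondCountableTopology X) (_ : ChartedSpace (EuclideanSpace ℝ (Fin 4)) X) (_ : IsManifold (𝓡 4) ((⊤ : ℕ∞) : WithTop ℕ∞) X) (g' : ℕ) (k' : Fin 3 → ℕ) (T' : Fin 3 → Set X) (ℓ : (Metric.sphere (0 : EuclideanSpace ℝ (Fin 2)) 1) → X), g' < g ∧ Literature.Topology.FourManifolds.IsGKTrisection X g' k' T' ∧ Manifold.IsSmoothEmbedding (𝓡 1) (𝓡 4) ((⊤ : ℕ∞) : WithTop ℕ∞) ℓ ∧ Literature.Topology.FourManifolds.IsCircleSurgery (𝓡 4) (𝓡 4) X M ℓ)) → ∀ (M : Type) [TopologicalSpace M] [T2Space M] [SecondCountableTopology M] [ChartedSpace (EuclideanSpace ℝ (Fin 4)) M] [IsManifold (𝓡 4) ((⊤ : ℕ∞) : WithTop ℕ∞) M], (M ≃ₕ (Metric.sphere (0 : EuclideanSpace ℝ (Fin 5)) 1)) → ∀ (g : ℕ) (k : Fin 3 → ℕ) (T : Fin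 3 → Set M), Literature.Topology.FourManifolds.IsGKTrisection M g k T → 3 ≤ g → Literature.Topology.FourManifolds.Trisection.IsWeaklyReducible T → Literature.Topology.FourManifolds.Trisection.IsReducible T ∨ (∃ (g₁ : ℕ) (k₁ : Fin 3 → ℕ) (T₁ : Fin 3 → Set M), g₁ < g ∧ Literature.Topology.FourManifolds.IsGKTrisection M g₁ k₁ T₁) ∨ (∃ (X : Type) (_ : TopologicalSpace X) (_ : T2Space X) (_ : SecondCountableTopology X) (_ : ChartedSpace (EuclideanSpace ℝ (Fin 4)) X) (_ : IsManifold (𝓡 4) ((⊤ : ℕ∞) : WithTop ℕ∞) X) (g' : ℕ) (k' : Fin 3 → ℕ) (T' : Fin 3 → Set X) (ℓ : (Metric.sphere (0 : EuclideanSpace ℝ (Fin 2)) 1) → X), g' < g ∧ Literature.Topology.FourManifolds.IsGKTrisection X g' k' T' ∧ Manifold.IsSmoothEmbedding (𝓡 1) (𝓡 4) ((⊤ : ℕ∞) : WithTop ℕ∞) ℓ ∧ Literature.Topology.FourManifolds.IsCircleSurgery (𝓡 4) (𝓡 4) X M ℓ) := by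
  intro h3 hD4 M _ _ _ _ _ e g k T hT hg hwr
  rcases Nat.lt_or_ge g 4 with hlt | hge
  · obtain rfl : g = 3 := by omega
    exact helper_loopDichotomy_genusThree_of_genusThreeBase h3 M e k T hT hwr
  · exact hD4 M e g k T hT hge hwr

end Summit.SmoothPoincare4.SmoothPoincare4.Theorems.WeakReductionReduces.LoopDichotomy

end
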